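import Literature.NumberTheory.LFunctions.ZetaPartialSumZeroBlocks
import Literature.NumberTheory.LFunctions.ZetaPartialSumLowZeros
import Literature.NumberTheory.LFunctions.ZetaZerosProofs
import HarnessLib

/-!
# Weighted sums of `m(ρ) |ζ_M(ρ) ζ_M(1-ρ)|` over all non-trivial zeros

Topic `Literature/NumberTheory/LFunctions`. Assembly of
`Literature/NumberTheory/LFunctions/ZetaPartialSumLowZeros.lean` (heights `≤ M`) and
`Literature/NumberTheory/LFunctions/ZetaPartialSumZeroBlocks.lean` (dyadic blocks above `M`):
for a weight `w(ρ) ≥ 0` with `w ≤ W₀` at heights `|γ| ≤ M` and `w ≤ Ω 64^{-j}` on the dyadic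
block `2^j M < |γ| ≤ 2^{j+1} M`, and ANY finite set `S` of non-trivial zeros (both signs of `γ`,
any real parts),
`∑_{ρ ∈ S} m(ρ) w(ρ) ‖ζ_M(ρ)‖ ‖ζ_M(1-ρ)‖ ≤ C (W₀ M + Ω (1 + log M)³ M)`
with an absolute constant `C` (`ζ_M(s) = ∑_{k ≤ M} k^{-s}`).  This is the form in which the zero
side of the explicit formula for a `ζ_M`-mollified test function is estimated: `w` is the product
of the transforms of the two bumps, `W₀` their trivial bound and `Ω 64^{-j}` their decay.

* `Literature.NumberTheory.LFunctions.sum_subtype_indicator_le_two_mul_sum_zerosBetween` — passing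
  from a finite set of zeros of both signs to `zerosBetween a b` (conjugation symmetry);
* `Literature.NumberTheory.LFunctions.exists_sum_weighted_norm_zetaPartialSum_mul_le` — the bound.

## References

* E. C. Titchmarsh, *The Theory of the Riemann Zeta-Function*, 2nd ed. (1986), Theorem 4.11,
  eq. (4.11.1); §2.12; Thm. 9.2.
-/

noncomputable section

open Complex Set Filter Finset
open scoped Real Topology ComplexConjugate

namespace Literature.NumberTheory.LFunctions

/-! ## Conjugation invariance of `‖ζ_M(ρ)‖ ‖ζ_M(1-ρ)‖` -/

/-- `∑_{k ≤ M} k^{-s̄} = conj ∑_{k ≤ M} k^{-s}`. [folklore] -/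
theorem sum_Icc_cpow_neg_conj (M : ℕ) (s : ℂ) :
    ∑ k ∈ Finset.Icc 1 M, (k : ℂ) ^ (-conj s) = conj (∑ k ∈ Finset.Icc 1 M, (k : ℂ) ^ (-s)) := by
  rw [map_sum]
  refine Finset.sum_congr rfl fun k _ ↦ ?_
  rw [← map_neg, Complex.cpow_conj _ _ (by rw [Complex.natCast_arg]; exact Real.pi_pos.ne),
    Complex.conj_natCast]

/-- The product `‖ζ_M(ρ)‖ ‖ζ_M(1-ρ)‖` is invariant under `ρ ↦ ρ̄`. [folklore] -/
theorem norm_zetaPartialSum_mul_conj (M : ℕ) (ρ : ℂ) :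
    ‖∑ k ∈ Finset.Icc 1 M, (k : ℂ) ^ (-conj ρ)‖ * ‖∑ k ∈ Finset.Icc 1 M, (k : ℂ) ^ (-(1 - conj ρ))‖
      = ‖∑ k ∈ Finset.Icc 1 M, (k : ℂ) ^ (-ρ)‖ * ‖∑ k ∈ Finset.Icc 1 M, (k : ℂ) ^ (-(1 - ρ))‖ := by
  rw [sum_Icc_cpow_neg_conj, Complex.norm_conj,
    show (1 : ℂ) - conj ρ = conj (1 - ρ) by simp, sum_Icc_cpow_neg_conj, Complex.norm_conj]

/-! ## From finite sets of zeros of both signs to `zerosBetween` -/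

/-- **Both signs of `γ`**: for `0 ≤ a`, `f ≥ 0` on the zeros with `f(ρ̄) = f(ρ)`, and a finite set
`S` of non-trivial zeros,
`∑_{ρ ∈ S, a < |Im ρ| ≤ b} m(ρ) f(ρ) ≤ 2 ∑_{ρ ∈ zerosBetween a b} m(ρ) f(ρ)`.
[cite: Titchmarsh1986, §2.12] -/
theorem sum_subtype_indicator_le_two_mul_sum_zerosBetween {a b : ℝ} (ha : 0 ≤ a) {f : ℂ → ℝ}
    (hf0 : ∀ ρ : ℂ, ρ ∈ ZetaZeros.riemannZetaNontrivialZeros → 0 ≤ f ρ) (hfc : ∀ ρ : ℂ, f (conj ρ) = f ρ) (S : Finset ZetaZeros.riemannZetaNontrivialZeros) :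
    ∑ ρ ∈ S, (if a < |(ρ : ℂ).im| ∧ |(ρ : ℂ).im| ≤ b then
        (riemannZetaZeroOrder (ρ : ℂ) : ℝ) * f ρ else 0)
      ≤ 2 * ∑ ρ ∈ SchoenfeldBound.zerosBetween a b, (riemannZetaZeroOrder ρ : ℝ) * f ρ := by
  classical
  set g : ℂ → ℝ := fun ρ ↦ (riemannZetaZeroOrder ρ : ℝ) * f ρ with hg
  have hg0 : ∀ ρ : ℂ, ρ ∈ ZetaZeros.riemannZetaNontrivialZeros → 0 ≤ g ρ := fun ρ hρ ↦ mul_nonneg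
    (by exact_mod_cast (zero_le_one.trans (ZetaZeros.riemannZetaNontrivialZeros.one_le_order hρ)))
    (hf0 ρ hρ)
  have hgc : ∀ ρ : ℂ, g (conj ρ) = g ρ := fun ρ ↦ by
    simp only [hg, hfc ρ, riemannZetaZeroOrder_conj_holds ρ]
  have hgB : ∀ ρ ∈ SchoenfeldBound.zerosBetween a b, 0 ≤ g ρ := fun ρ hρ ↦
    hg0 ρ (SchoenfeldBound.mem_nontrivialZeros_of_mem_zerosBetween ha hρ)
  -- split according to the sign of `Im ρ`
  set Sp : Finset ZetaZeros.riemannZetaNontrivialZeros := S.filter (fun ρ : ZetaZeros.riemannZetaNontrivialZeros ↦ a < |(ρ : ℂ).im| ∧ |(ρ : ℂ).im| ≤ b ∧ 0 < (ρ : ℂ).im)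
    with hSp
  set Sn : Finset ZetaZeros.riemannZetaNontrivialZeros := S.filter (fun ρ : ZetaZeros.riemannZetaNontrivialZeros ↦ a < |(ρ : ℂ).im| ∧ |(ρ : ℂ).im| ≤ b ∧ (ρ : ℂ).im < 0)
    with hSn
  have hsplit : ∑ ρ ∈ S, (if a < |(ρ : ℂ).im| ∧ |(ρ : ℂ).im| ≤ b then g ρ else 0)
      = ∑ ρ ∈ Sp, g ρ + ∑ ρ ∈ Sn, g ρ := by
    rw [hSp, hSn, Finset.sum_filter, Finset.sum_filter, ← Finset.sum_add_distrib]
    refine Finset.sum_congr rfl fun ρ _ ↦ ?_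
    have him := ZetaZeros.riemannZetaNontrivialZeros.im_ne_zero ρ.2
    by_cases h : a < |(ρ : ℂ).im| ∧ |(ρ : ℂ).im| ≤ b
    · rcases lt_or_gt_of_ne him with hneg | hpos
      · simp [h, hneg, not_lt.2 hneg.le]
      · simp [h, hpos, not_lt.2 hpos.le]
    · rw [if_neg h, if_neg (fun hh ↦ h ⟨hh.1, hh.2.1⟩), if_neg (fun hh ↦ h ⟨hh.1, hh.2.1⟩),
        add_zero]
  change ∑ ρ ∈ S, (if a < |(ρ : ℂ).im| ∧ |(ρ : ℂ).im| ≤ b then g ρ else 0)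
    ≤ 2 * ∑ ρ ∈ SchoenfeldBound.zerosBetween a b, g ρ
  rw [hsplit, two_mul]
  apply add_le_add
  · -- positive ordinates: `Sp ↪ zerosBetween a b` by the inclusion
    have himage : ∑ ρ ∈ Sp, g ρ = ∑ z ∈ Sp.image (fun ρ : ZetaZeros.riemannZetaNontrivialZeros ↦ (ρ : ℂ)), g z := by
      rw [Finset.sum_image fun x _ y _ h ↦ Subtype.ext h]
    rw [himage]
    refine Finset.sum_le_sum_of_subset_of_nonneg ?_ fun z hz _ ↦ hgB z hz
    intro z hz
    obtain ⟨ρ, hρ, rfl⟩ := Finset.mem_image.1 hz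
    obtain ⟨-, h1, h2, h3⟩ := Finset.mem_filter.1 hρ
    rw [abs_of_pos h3] at h1 h2
    exact (SchoenfeldBound.mem_zerosBetween ha).2
      ⟨ZetaZeros.riemannZetaNontrivialZeros.zeta_eq_zero ρ.2,
        (ZetaZeros.riemannZetaNontrivialZeros.re_pos ρ.2).le,
        (ZetaZeros.riemannZetaNontrivialZeros.re_lt_one ρ.2).le, h1, h2⟩
  · -- negative ordinates: `Sn ↪ zerosBetween a b` by conjugation
    have himage : ∑ ρ ∈ Sn, g ρ = ∑ z ∈ Sn.image (fun ρ : ZetaZeros.riemannZetaNontrivialZeros ↦ conj (ρ : ℂ)), g z := by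
      rw [Finset.sum_image fun x _ y _ h ↦ Subtype.ext (by simpa using congrArg conj h)]
      exact Finset.sum_congr rfl fun ρ _ ↦ (hgc _).symm
    rw [himage]
    refine Finset.sum_le_sum_of_subset_of_nonneg ?_ fun z hz _ ↦ hgB z hz
    intro z hz
    obtain ⟨ρ, hρ, rfl⟩ := Finset.mem_image.1 hz
    obtain ⟨-, h1, h2, h3⟩ := Finset.mem_filter.1 hρ
    rw [abs_of_neg h3] at h1 h2
    refine (SchoenfeldBound.mem_zerosBetween ha).2 ⟨?_, ?_, ?_, ?_, ?_⟩
    · rw [riemannZeta_conj, ZetaZeros.riemannZetaNontrivialZeros.zeta_eq_zero ρ.2, map_zero]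
    · simpa using (ZetaZeros.riemannZetaNontrivialZeros.re_pos ρ.2).le
    · simpa using (ZetaZeros.riemannZetaNontrivialZeros.re_lt_one ρ.2).le
    · simpa using h1
    · simpa using h2

/-! ## The dyadic index of a height above `M` -/

/-- Every height `|γ| > M` lies in a dyadic block `2^j M < |γ| ≤ 2^{j+1} M` with `j ≤ J` as soon as
`|γ| ≤ 2^{J+1} M`. [folklore] -/
theorem exists_dyadic_index {M y : ℝ} (hy : M < y) {J : ℕ} (hJ : y ≤ 2 ^ (J + 1) * M) :
    ∃ j : ℕ, j ≤ J ∧ 2 ^ j * M < y ∧ y ≤ 2 ^ (j + 1) * M := by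
  classical
  have hex : ∃ j : ℕ, y ≤ 2 ^ (j + 1) * M := ⟨J, hJ⟩
  refine ⟨Nat.find hex, Nat.find_min' hex hJ, ?_, Nat.find_spec hex⟩
  rcases Nat.eq_zero_or_pos (Nat.find hex) with h0 | hpos
  · rw [h0]; simpa using hy
  · have hmin := Nat.find_min hex (Nat.sub_one_lt_of_lt hpos)
    push Not at hmin
    have e : Nat.find hex - 1 + 1 = Nat.find hex := Nat.sub_add_cancel hpos
    rw [e] at hmin
    exact hmin

/-- `(j+2)³ ≤ 8 · 4^j`. [folklore] -/
theorem cube_le_eight_mul_four_pow (j : ℕ) : ((j : ℝ) + 2) ^ 3 ≤ 8 * 4 ^ j := by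
  induction j with
  | zero => norm_num
  | succ j ih =>
    have h4 : (4 : ℝ) ^ (j + 1) = 4 * 4 ^ j := by ring
    have hj : (0 : ℝ) ≤ j := Nat.cast_nonneg j
    have key : ((j : ℝ) + 1 + 2) ^ 3 ≤ 4 * ((j : ℝ) + 2) ^ 3 := by
      nlinarith [mul_nonneg (mul_nonneg hj hj) hj, mul_nonneg hj hj, hj]
    push_cast
    rw [h4]
    linarith

/-! ## The weighted total -/

/-- **Weighted sum of `m(ρ) ‖ζ_M(ρ)‖ ‖ζ_M(1-ρ)‖` over arbitrary finite sets of zeros.** There is an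
absolute constant `C` such that for all `M ≥ 1`, `W₀, Ω ≥ 0` and every weight `w ≥ 0` on the
non-trivial zeros with `w(ρ) ≤ W₀` for `|Im ρ| ≤ M` and `w(ρ) ≤ Ω/64^j` for
`2^j M < |Im ρ| ≤ 2^{j+1} M` (`j ≥ 0`), and every finite set `S` of non-trivial zeros,
`∑_{ρ ∈ S} m(ρ) w(ρ) ‖ζ_M(ρ)‖ ‖ζ_M(1-ρ)‖ ≤ C (W₀ M + Ω (1 + log M)³ M)`.
[cite: Titchmarsh1986, Theorem 4.11, eq. (4.11.1); Thm. 9.2] -/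
theorem exists_sum_weighted_norm_zetaPartialSum_mul_le :
    ∃ C : ℝ, 0 < C ∧ ∀ M : ℕ, 1 ≤ M → ∀ W₀ Ω : ℝ, 0 ≤ W₀ → 0 ≤ Ω → ∀ w : ZetaZeros.riemannZetaNontrivialZeros → ℝ,
      (∀ ρ : ZetaZeros.riemannZetaNontrivialZeros, 0 ≤ w ρ) →
      (∀ ρ : ZetaZeros.riemannZetaNontrivialZeros, |(ρ : ℂ).im| ≤ M → w ρ ≤ W₀) →
      (∀ (j : ℕ) (ρ : ZetaZeros.riemannZetaNontrivialZeros), (2 : ℝ) ^ j * M < |(ρ : ℂ).im| → |(ρ : ℂ).im| ≤ (2 : ℝ) ^ (j + 1) * M →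
          w ρ ≤ Ω / 64 ^ j) →
      ∀ S : Finset ZetaZeros.riemannZetaNontrivialZeros,
        ∑ ρ ∈ S, (riemannZetaZeroOrder (ρ : ℂ) : ℝ) * (w ρ *
            (‖∑ k ∈ Finset.Icc 1 M, (k : ℂ) ^ (-(ρ : ℂ))‖ *
              ‖∑ k ∈ Finset.Icc 1 M, (k : ℂ) ^ (-(1 - (ρ : ℂ)))‖))
          ≤ C * (W₀ * M + Ω * (1 + Real.log M) ^ 3 * M) := by
  classical
  obtain ⟨C₁, hC₁, hlow⟩ := exists_sum_zerosBetween_low_norm_zetaPartialSum_mul_le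
  obtain ⟨C₂, hC₂, hblk⟩ := exists_sum_zerosBetween_norm_zetaPartialSum_mul_le
  refine ⟨2 * C₁ + 32 * C₂, by positivity, ?_⟩
  intro M hM W₀ Ω hW₀ hΩ w hw0 hwlow hwhigh S
  have hM0 : (0 : ℝ) < M := by exact_mod_cast hM
  have hM1 : (1 : ℝ) ≤ M := by exact_mod_cast hM
  -- the summand without the weight
  set X : ℂ → ℝ := fun ρ ↦ ‖∑ k ∈ Finset.Icc 1 M, (k : ℂ) ^ (-ρ)‖ *
    ‖∑ k ∈ Finset.Icc 1 M, (k : ℂ) ^ (-(1 - ρ))‖ with hX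
  have hX0 : ∀ ρ, 0 ≤ X ρ := fun ρ ↦ by positivity
  have hXc : ∀ ρ, X (conj ρ) = X ρ := fun ρ ↦ norm_zetaPartialSum_mul_conj M ρ
  have hm0 : ∀ ρ : ZetaZeros.riemannZetaNontrivialZeros, (0 : ℝ) ≤ riemannZetaZeroOrder (ρ : ℂ) := fun ρ ↦ by
    exact_mod_cast zero_le_one.trans (ZetaZeros.riemannZetaNontrivialZeros.one_le_order ρ.2)
  -- a dyadic ceiling for the heights in `S`
  obtain ⟨J, hJ⟩ : ∃ J : ℕ, ∀ ρ ∈ S, |(ρ : ℂ).im| ≤ 2 ^ (J + 1) * M := by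
    obtain ⟨B, hB⟩ := Finset.exists_le (S.image fun ρ : ZetaZeros.riemannZetaNontrivialZeros ↦ |(ρ : ℂ).im|)
    refine ⟨⌈B⌉₊, fun ρ hρ ↦ ?_⟩
    have h1 : |(ρ : ℂ).im| ≤ B := hB _ (Finset.mem_image_of_mem _ hρ)
    have h2 : B ≤ (⌈B⌉₊ : ℝ) := Nat.le_ceil B
    have h3 : ((⌈B⌉₊ : ℕ) : ℝ) ≤ 2 ^ (⌈B⌉₊ + 1) := by
      have := Nat.lt_two_pow_self (n := ⌈B⌉₊ + 1)
      have : ((⌈B⌉₊ + 1 : ℕ) : ℝ) < (2 : ℝ) ^ (⌈B⌉₊ + 1) := by exact_mod_cast this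
      push_cast at this; linarith
    calc |(ρ : ℂ).im| ≤ 2 ^ (⌈B⌉₊ + 1) := by linarith
      _ ≤ 2 ^ (⌈B⌉₊ + 1) * M := le_mul_of_one_le_right (by positivity) hM1
  -- pointwise majorant: `w X ≤ W₀ 1_{low} X + ∑_j (Ω/64^j) 1_{block j} X`
  have hpt : ∀ ρ ∈ S, (riemannZetaZeroOrder (ρ : ℂ) : ℝ) * (w ρ * X ρ)
      ≤ W₀ * (if 0 < |(ρ : ℂ).im| ∧ |(ρ : ℂ).im| ≤ M then
            (riemannZetaZeroOrder (ρ : ℂ) : ℝ) * X ρ else 0)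
        + ∑ j ∈ Finset.range (J + 1), Ω / 64 ^ j *
            (if (2 : ℝ) ^ j * M < |(ρ : ℂ).im| ∧ |(ρ : ℂ).im| ≤ ((2 ^ j * M + 2 ^ j * M : ℕ) : ℝ) then
              (riemannZetaZeroOrder (ρ : ℂ) : ℝ) * X ρ else 0) := by
    intro ρ hρ
    have him := ZetaZeros.riemannZetaNontrivialZeros.im_ne_zero ρ.2
    have habs : 0 < |(ρ : ℂ).im| := abs_pos.2 him
    have hmX : 0 ≤ (riemannZetaZeroOrder (ρ : ℂ) : ℝ) * X ρ := mul_nonneg (hm0 ρ) (hX0 _)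
    have hsum0 : 0 ≤ ∑ j ∈ Finset.range (J + 1), Ω / 64 ^ j *
        (if (2 : ℝ) ^ j * M < |(ρ : ℂ).im| ∧ |(ρ : ℂ).im| ≤ ((2 ^ j * M + 2 ^ j * M : ℕ) : ℝ) then
          (riemannZetaZeroOrder (ρ : ℂ) : ℝ) * X ρ else 0) :=
      Finset.sum_nonneg fun j _ ↦ mul_nonneg (by positivity) (by split_ifs <;> simp [hmX])
    by_cases hle : |(ρ : ℂ).im| ≤ M
    · rw [if_pos ⟨habs, hle⟩]
      have : (riemannZetaZeroOrder (ρ : ℂ) : ℝ) * (w ρ * X ρ)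
          ≤ W₀ * ((riemannZetaZeroOrder (ρ : ℂ) : ℝ) * X ρ) := by
        have := hwlow ρ hle
        calc (riemannZetaZeroOrder (ρ : ℂ) : ℝ) * (w ρ * X ρ)
            = w ρ * ((riemannZetaZeroOrder (ρ : ℂ) : ℝ) * X ρ) := by ring
          _ ≤ W₀ * ((riemannZetaZeroOrder (ρ : ℂ) : ℝ) * X ρ) :=
            mul_le_mul_of_nonneg_right this hmX
      linarith
    · push Not at hle
      obtain ⟨j, hjJ, hj1, hj2⟩ := exists_dyadic_index hle (hJ ρ hρ)
      have hcast : ((2 ^ j * M + 2 ^ j * M : ℕ) : ℝ) = 2 ^ (j + 1) * M := by push_cast; ring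
      have hterm : (riemannZetaZeroOrder (ρ : ℂ) : ℝ) * (w ρ * X ρ)
          ≤ Ω / 64 ^ j * (if (2 : ℝ) ^ j * M < |(ρ : ℂ).im| ∧
              |(ρ : ℂ).im| ≤ ((2 ^ j * M + 2 ^ j * M : ℕ) : ℝ) then
                (riemannZetaZeroOrder (ρ : ℂ) : ℝ) * X ρ else 0) := by
        rw [if_pos ⟨hj1, by rw [hcast]; exact hj2⟩]
        have := hwhigh j ρ hj1 hj2
        calc (riemannZetaZeroOrder (ρ : ℂ) : ℝ) * (w ρ * X ρ)
            = w ρ * ((riemannZetaZeroOrder (ρ : ℂ) : ℝ) * X ρ) := by ring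
          _ ≤ Ω / 64 ^ j * ((riemannZetaZeroOrder (ρ : ℂ) : ℝ) * X ρ) :=
            mul_le_mul_of_nonneg_right this hmX
      have hsingle : Ω / 64 ^ j * (if (2 : ℝ) ^ j * M < |(ρ : ℂ).im| ∧
            |(ρ : ℂ).im| ≤ ((2 ^ j * M + 2 ^ j * M : ℕ) : ℝ) then
              (riemannZetaZeroOrder (ρ : ℂ) : ℝ) * X ρ else 0)
          ≤ ∑ j ∈ Finset.range (J + 1), Ω / 64 ^ j *
            (if (2 : ℝ) ^ j * M < |(ρ : ℂ).im| ∧ |(ρ : ℂ).im| ≤ ((2 ^ j * M + 2 ^ j * M : ℕ) : ℝ) then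
              (riemannZetaZeroOrder (ρ : ℂ) : ℝ) * X ρ else 0) :=
        Finset.single_le_sum (f := fun j ↦ Ω / 64 ^ j *
            (if (2 : ℝ) ^ j * M < |(ρ : ℂ).im| ∧ |(ρ : ℂ).im| ≤ ((2 ^ j * M + 2 ^ j * M : ℕ) : ℝ) then
              (riemannZetaZeroOrder (ρ : ℂ) : ℝ) * X ρ else 0))
          (fun j _ ↦ mul_nonneg (by positivity) (by split_ifs <;> simp [hmX]))
          (Finset.mem_range.2 (Nat.lt_succ_of_le hjJ))
      have hlow0 : 0 ≤ W₀ * (if 0 < |(ρ : ℂ).im| ∧ |(ρ : ℂ).im| ≤ M then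
          (riemannZetaZeroOrder (ρ : ℂ) : ℝ) * X ρ else 0) :=
        mul_nonneg hW₀ (by split_ifs <;> simp [hmX])
      linarith
  refine (Finset.sum_le_sum hpt).trans ?_
  rw [Finset.sum_add_distrib, ← Finset.mul_sum, Finset.sum_comm]
  simp_rw [← Finset.mul_sum]
  -- the low part
  have hXmem : ∀ ρ : ℂ, ρ ∈ ZetaZeros.riemannZetaNontrivialZeros → 0 ≤ X ρ := fun ρ _ ↦ hX0 ρ
  have hL := sum_subtype_indicator_le_two_mul_sum_zerosBetween (a := 0) (b := (M : ℝ)) le_rfl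
    hXmem hXc S
  have hL' : ∑ ρ ∈ S, (if 0 < |(ρ : ℂ).im| ∧ |(ρ : ℂ).im| ≤ M then
      (riemannZetaZeroOrder (ρ : ℂ) : ℝ) * X ρ else 0) ≤ 2 * (C₁ * M) :=
    hL.trans (mul_le_mul_of_nonneg_left (hlow M hM) (by norm_num))
  -- the blocks
  have hB : ∀ j ∈ Finset.range (J + 1), Ω / 64 ^ j * ∑ ρ ∈ S,
      (if (2 : ℝ) ^ j * M < |(ρ : ℂ).im| ∧ |(ρ : ℂ).im| ≤ ((2 ^ j * M + 2 ^ j * M : ℕ) : ℝ) then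
        (riemannZetaZeroOrder (ρ : ℂ) : ℝ) * X ρ else 0)
      ≤ Ω * (16 * C₂) * (1 + Real.log M) ^ 3 * M * (1 / 2) ^ j := by
    intro j _
    set T : ℕ := 2 ^ j * M with hT
    have hTR : (T : ℝ) = 2 ^ j * M := by rw [hT]; push_cast; ring
    have hMT : M ≤ T := by rw [hT]; exact Nat.le_mul_of_pos_left M (pow_pos two_pos j)
    have hT0 : (0 : ℝ) ≤ T := Nat.cast_nonneg T
    have h2j : (1 : ℝ) ≤ 2 ^ j := one_le_pow₀ (by norm_num)
    have hsub := sum_subtype_indicator_le_two_mul_sum_zerosBetween (a := (T : ℝ))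
      (b := ((T + T : ℕ) : ℝ)) hT0 hXmem hXc S
    have hb := hblk M T hM hMT
    rw [hTR] at hsub hb
    -- `log(2T+2) ≤ (j+2)(1 + log M)`
    have hlog : Real.log (2 * (2 ^ j * (M : ℝ)) + 2) ≤ ((j : ℝ) + 2) * (1 + Real.log M) := by
      have h22 : (2 : ℝ) ^ (j + 2) = 2 ^ j * 4 := by rw [pow_add]; norm_num
      have h1 : 2 * (2 ^ j * (M : ℝ)) + 2 ≤ 2 ^ (j + 2) * M := by
        rw [h22]; nlinarith
      have h2 : Real.log (2 ^ (j + 2) * (M : ℝ)) = (j + 2) * Real.log 2 + Real.log M := by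
        rw [Real.log_mul (by positivity) hM0.ne', Real.log_pow]; push_cast; ring
      have hl2 : Real.log 2 ≤ 1 := by
        have := Real.log_two_lt_d9; linarith
      have hlM : 0 ≤ Real.log (M : ℝ) := Real.log_nonneg hM1
      calc Real.log (2 * (2 ^ j * (M : ℝ)) + 2) ≤ Real.log (2 ^ (j + 2) * (M : ℝ)) :=
            Real.log_le_log (by positivity) h1
        _ = (j + 2) * Real.log 2 + Real.log M := h2
        _ ≤ (j + 2) * 1 + Real.log M := by gcongr
        _ ≤ ((j : ℝ) + 2) * (1 + Real.log M) := by nlinarith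
    have hlog0 : 0 ≤ Real.log (2 * (2 ^ j * (M : ℝ)) + 2) := Real.log_nonneg (by nlinarith)
    -- `(T/M)^{3/2} ≤ (T/M)^2 = 4^j`
    have hpow : ((2 ^ j * (M : ℝ)) / M) ^ (3 / 2 : ℝ) ≤ 4 ^ j := by
      have hq : (2 ^ j * (M : ℝ)) / M = 2 ^ j := by field_simp
      rw [hq]
      calc ((2 : ℝ) ^ j) ^ (3 / 2 : ℝ) ≤ ((2 : ℝ) ^ j) ^ (2 : ℝ) :=
            Real.rpow_le_rpow_of_exponent_le h2j (by norm_num)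
        _ = 4 ^ j := by rw [Real.rpow_two, ← pow_mul, pow_mul']; norm_num
    have hblock : ∑ ρ ∈ SchoenfeldBound.zerosBetween (2 ^ j * (M : ℝ)) ((T + T : ℕ) : ℝ),
        (riemannZetaZeroOrder ρ : ℝ) * X ρ
        ≤ C₂ * (((j : ℝ) + 2) ^ 3 * (1 + Real.log M) ^ 3) * (2 ^ j * M) * 4 ^ j := by
      refine hb.trans ?_
      have e1 : Real.log (2 * (2 ^ j * (M : ℝ)) + 2) ^ 3 ≤ ((j : ℝ) + 2) ^ 3 * (1 + Real.log M) ^ 3 := by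
        rw [← mul_pow]; exact pow_le_pow_left₀ hlog0 hlog 3
      exact mul_le_mul (mul_le_mul_of_nonneg_right (mul_le_mul_of_nonneg_left e1 hC₂.le)
        (by positivity)) hpow (by positivity) (by positivity)
    have hcube := cube_le_eight_mul_four_pow j
    have hid : (4 : ℝ) ^ j * 2 ^ j * 4 ^ j / 64 ^ j = (1 / 2) ^ j := by
      rw [← mul_pow, ← mul_pow, ← div_pow]; norm_num
    have hL3 : 0 ≤ (1 + Real.log (M : ℝ)) ^ 3 := by
      have : 0 ≤ Real.log (M : ℝ) := Real.log_nonneg hM1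
      positivity
    calc Ω / 64 ^ j * ∑ ρ ∈ S,
          (if (2 : ℝ) ^ j * M < |(ρ : ℂ).im| ∧ |(ρ : ℂ).im| ≤ ((T + T : ℕ) : ℝ) then
            (riemannZetaZeroOrder (ρ : ℂ) : ℝ) * X ρ else 0)
        ≤ Ω / 64 ^ j * (2 * (C₂ * (((j : ℝ) + 2) ^ 3 * (1 + Real.log M) ^ 3) * (2 ^ j * M) * 4 ^ j)) :=
          mul_le_mul_of_nonneg_left (hsub.trans (mul_le_mul_of_nonneg_left hblock (by norm_num)))
            (by positivity)
      _ ≤ Ω / 64 ^ j * (2 * (C₂ * ((8 * 4 ^ j) * (1 + Real.log M) ^ 3) * (2 ^ j * M) * 4 ^ j)) := by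
          gcongr
      _ = Ω * (16 * C₂) * (1 + Real.log M) ^ 3 * M * ((4 : ℝ) ^ j * 2 ^ j * 4 ^ j / 64 ^ j) := by
          ring
      _ = Ω * (16 * C₂) * (1 + Real.log M) ^ 3 * M * (1 / 2) ^ j := by rw [hid]
  have hgeom : ∑ j ∈ Finset.range (J + 1), (1 / 2 : ℝ) ^ j ≤ 2 := by
    have h := geom_sum_Ico_le_of_lt_one (m := 0) (n := J + 1) (x := (1 / 2 : ℝ)) (by norm_num)
      (by norm_num)
    rw [Finset.range_eq_Ico]
    refine h.trans ?_
    norm_num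
  have hBsum : ∑ j ∈ Finset.range (J + 1), Ω / 64 ^ j * ∑ ρ ∈ S,
      (if (2 : ℝ) ^ j * M < |(ρ : ℂ).im| ∧ |(ρ : ℂ).im| ≤ ((2 ^ j * M + 2 ^ j * M : ℕ) : ℝ) then
        (riemannZetaZeroOrder (ρ : ℂ) : ℝ) * X ρ else 0)
      ≤ Ω * (16 * C₂) * (1 + Real.log M) ^ 3 * M * 2 := by
    refine (Finset.sum_le_sum hB).trans ?_
    rw [← Finset.mul_sum]
    exact mul_le_mul_of_nonneg_left hgeom (by positivity)
  have hlogM : 0 ≤ Real.log (M : ℝ) := Real.log_nonneg hM1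
  calc W₀ * ∑ ρ ∈ S, (if 0 < |(ρ : ℂ).im| ∧ |(ρ : ℂ).im| ≤ M then
          (riemannZetaZeroOrder (ρ : ℂ) : ℝ) * X ρ else 0)
        + ∑ j ∈ Finset.range (J + 1), Ω / 64 ^ j * ∑ ρ ∈ S,
          (if (2 : ℝ) ^ j * M < |(ρ : ℂ).im| ∧ |(ρ : ℂ).im| ≤ ((2 ^ j * M + 2 ^ j * M : ℕ) : ℝ) then
            (riemannZetaZeroOrder (ρ : ℂ) : ℝ) * X ρ else 0)
      ≤ W₀ * (2 * (C₁ * M)) + Ω * (16 * C₂) * (1 + Real.log M) ^ 3 * M * 2 :=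
        add_le_add (mul_le_mul_of_nonneg_left hL' hW₀) hBsum
    _ ≤ (2 * C₁ + 32 * C₂) * (W₀ * M + Ω * (1 + Real.log M) ^ 3 * M) := by
        have h1 : 0 ≤ W₀ * M := by positivity
        have h2 : 0 ≤ Ω * (1 + Real.log M) ^ 3 * M := by positivity
        nlinarith

end Literature.NumberTheory.LFunctions
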